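import Summits.RiemannHypothesis.RiemannHypothesis.Theorems.WeilColumnThetaUCT2
import Summits.RiemannHypothesis.RiemannHypothesis.Theorems.WeilColumnThetaStep5T2
import Summits.RiemannHypothesis.RiemannHypothesis.Theorems.ThetaTier2CrossGlue
import HarnessLib

/-!
# THE TIER-2 ANALYTIC THEOREM: `T2Valid A X` ⇒ `a*(S_q) < (log q⁺)/2` (composition of the E-side with the kernel's (K1)–(K7); RH-FREE)

WEIL column (LADDER-RH, W-P(P2); route `WeilSemilocal`, tier-2 twin residue, item 19172; cc-s2-1 gen22 TIER2-KERNEL-SPEC §0/§5,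
cc-s2-3 gen23 TIER2-SOUNDNESS-PLAN v1.1 §0/§6). cc-s2-1's `ThetaTier2.certify_sound` turns the kernel verdict `certifyT2 A = true` into
`T2Valid A X` for any real data `X : RealAtoms` the input encloses; cc-s2-3's `ucT2_of_bounds` turns five real hypotheses (`Ā`, `B̄`, the
unmollified prime bound, the layer constant, the certificate inequality) into UC(q). This file supplies the middle: it says WHAT the reals
`X` must be for a row `P : ThetaParams` — the checklist `T2Matches P A X` (equalities `X.θ₀ = P.θ₀, …`, one-sided atom facts
`P.u₁ ≤ X.u₁, P.M ≤ X.Mb, …`, the side conditions `η ≤ Jt·τ`, `1/(m+1) ≤ Kw·τ`, the cut values' meaning `irwinHall m (m(j+1)τ/η) ≤ X.cb j`,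
`|χ′(x₁−t)| ≤ X.cpb j`, the layer window, the gain profile `X.Ra j ≤ R(τ₁(w_j))`, …) — and proves

**`ucT2_of_valid`**: `P.Admissible qn → ConsecutivePrimes P.q qn → (ψ ≤ X.C·x on [e^{−2x₁}, ∞)) → T2Matches P A X → T2Valid A X →
weilSemilocalThreshold (primesBelow P.q) < log qn / 2`,

from E2 (`tailEnv_le_sine`, `norm_deriv_T_depth_le_sine`), E3 (`integral_norm_sq_TROdd_le_cell`, `integral_norm_sq_deriv_TOdd_le_cell`),
the prime side `norm_weilPrimeTerm_TROdd_le_T2` through tier2-p2's `T2Valid.cellEnvelope_all`/`cross_hyps`, cc-s2-3's `layer_majorant_ML₂`,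
and `ucT2_of_bounds`. The remaining per-row work is `AtomsOK A X ∧ T2Matches P A X` for `X = atomsOf P` (the atoms layer) and
`certifyT2 A = true` (`decide`). Nothing here bears on the truth of RH.
-/

noncomputable section

set_option linter.dupNamespace false

open Complex Set MeasureTheory Filter Finset
open scoped Real Topology

namespace Summit.RiemannHypothesis.RiemannHypothesis.Theorems.WeilColumn.ThetaMellin

open Literature.NumberTheory.LFunctions Literature.NumberTheory.LFunctions.WeilContinuous ThetaParams
open Summit.RiemannHypothesis.RiemannHypothesis.Theorems
open Summit.RiemannHypothesis.RiemannHypothesis.Theorems.ThetaTier2 (Inp RealAtoms T2Valid val envE envEp envX GsR lagSum sLayerN Sfun S1fun envExt)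

namespace ThetaParams

/-- **What the kernel's reals must be for the row `P`** (the E-side meaning of `X : RealAtoms` and of the data fields of `A`):
equalities for the quantities entering E1/E2 non-linearly, one-sided bounds for the rest, and the side conditions of THETA-CERT-cc6 §E.
[this seat; TIER2-KERNEL-SPEC §1/§4/§5; TIER2-SOUNDNESS-PLAN §6] -/
structure T2Matches (P : ThetaParams) (A : Inp) (X : RealAtoms) : Prop where
  m_eq : A.m = P.m
  τ_pos : 0 < X.τ
  θ₀_eq : X.θ₀ = P.θ₀
  M₀_eq : X.M₀ = P.M₀
  M₁₀_eq : X.M₁₀ = P.M₁₀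
  c₂_eq : X.c₂ = P.c₂
  ε_eq : X.ε = P.ε
  R_ge : zetaTail (P.m + 1) - ∑ k ∈ Ico 1 (A.K + 1), 1 / (k : ℝ) ^ (P.m + 1) ≤ X.R
  R_nonneg : 0 ≤ X.R
  Rm_ge : zetaTail P.m - ∑ k ∈ Ico 1 (A.K + 1), 1 / (k : ℝ) ^ P.m ≤ X.Rm
  Rm_nonneg : 0 ≤ X.Rm
  u₁_ge : P.u₁ ≤ X.u₁
  Mb_ge : P.M ≤ X.Mb
  Mb1_ge : P.M₁ ≤ X.Mb1
  E1_ge : Real.exp (-(2 * P.m + 1 : ℝ) * ((A.Jt : ℝ) * X.τ)) ≤ X.E1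
  E2_ge : Real.exp (-(2 * P.m : ℝ) * ((A.Jt : ℝ) * X.τ)) ≤ X.E2
  E3_ge : Real.exp (-(2 * P.m - 1 : ℝ) * ((A.Jt : ℝ) * X.τ)) ≤ X.E3
  eta_le_D : P.η ≤ (A.Jt : ℝ) * X.τ
  Wl_ge : 1 / ((P.m : ℝ) + 1) ≤ (A.Kw : ℝ) * X.τ
  t0_pos : 0 < X.t0
  t0_le_one : X.t0 ≤ 1
  e0_ge : Real.exp (X.t0 / 2) ≤ X.e0
  cA_ge : max 0 (2 * Jexplicit X.t0 - Real.log (4 * π) - Real.eulerMascheroniConstant - archC₁) ≤ X.cA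
  Λ_ge : vonMangoldtSum (P.m + 1) ≤ X.Λ
  C_nonneg : 0 ≤ X.C
  T_ge : zetaTail (P.m + 1) ^ 2 * Real.exp (-(P.m : ℝ) * ((A.Kw : ℝ) * X.τ)) *
    ((A.Kw : ℝ) * X.τ / P.m + 1 / (P.m : ℝ) ^ 2) ≤ X.T
  Gt_ge : zetaTail (P.m + 1) ^ 2 * ((A.Kw : ℝ) * X.τ) * Real.exp (-((P.m : ℝ) + 1) * ((A.Kw : ℝ) * X.τ)) ≤ X.Gt
  z_ge : zetaTail (P.m + 1) ≤ X.z
  zm1H_ge : zetaTail (P.m + 1) ≤ val A.zm1H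
  eml_ge : Real.exp (P.m * (2 * P.δ - P.η)) ≤ X.eml
  χ_ge : P.chiL ≤ X.χ
  ra_ge : 4 * P.δ * Real.exp P.δ * P.hmax ≤ X.ra
  rb_ge : 2 * P.δ * (Real.exp P.δ / Real.sqrt P.q) ≤ X.rb
  rc_ge : 2 * Real.log P.q / Real.sqrt P.q ≤ X.rc
  L_le : X.L ≤ Real.log P.q
  gain_len_pos : 0 < A.gainPairs.length
  d_nonneg : 0 ≤ X.d
  d_le : X.d ≤ P.δ / A.gainPairs.length
  Ra_nonneg : ∀ j, 0 ≤ X.Ra j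
  Ra_le : ∀ j < A.gainPairs.length, X.Ra j ≤
    P.Rtop (((P.δ * j / A.gainPairs.length) - (P.δ * j / A.gainPairs.length) ^ 2 / 2) / (2 * P.δ))
  Rb_nonneg : ∀ j, 0 ≤ X.Rb j
  Rb_le : ∀ j < A.gainPairs.length, X.Rb j ≤
    P.Rtop (((2 * P.δ - P.δ * (j + 1) / A.gainPairs.length) - (2 * P.δ - P.δ * (j + 1) / A.gainPairs.length) ^ 2 / 2) / (2 * P.δ))
  cb_ge : ∀ j < A.Jt, irwinHall P.m (P.m * (((j : ℝ) + 1) * X.τ) / P.η) ≤ X.cb j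
  cpb_ge : ∀ j < A.Jt, ∀ t : ℝ, (j : ℝ) * X.τ ≤ t → t ≤ ((j : ℝ) + 1) * X.τ →
    |(bsplineDensity (P.η / (2 * P.m)) (P.m - 1) (P.x₁ - t + P.a - P.η / 2)).re| ≤ X.cpb j
  layer_lo : A.j0 < A.j1p → (A.j0 : ℝ) * X.τ ≤ P.η - 2 * P.δ
  layer_hi : A.j0 < A.j1p → P.η ≤ (A.j1p : ℝ) * X.τ

variable {P : ThetaParams} {A : Inp} {X : RealAtoms}

/-! ## §1 The kernel's cell envelopes dominate `tailEnv` and `‖T′(x₁ − ·)‖/√u₁` -/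

/-- `0 ≤ Sfun` when `R ≥ 0`. [folklore] -/
theorem Sfun_nonneg {θ₀ R : ℝ} (hR : 0 ≤ R) (m K : ℕ) (t : ℝ) : 0 ≤ Sfun θ₀ R m K t := by
  unfold Sfun
  exact add_nonneg (Finset.sum_nonneg fun k _ ↦ by positivity) hR

/-- `0 ≤ S1fun` when `Rm, c₂, ε ≥ 0`, `θ₀ > 0`. [folklore] -/
theorem S1fun_nonneg {θ₀ c₂ ε Rm : ℝ} (hθ : 0 < θ₀) (hc : 0 ≤ c₂) (hε : 0 ≤ ε) (hRm : 0 ≤ Rm) (m K : ℕ) (t : ℝ) :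
    0 ≤ S1fun θ₀ c₂ ε Rm m K t := by
  unfold S1fun
  have hpos : 0 < θ₀ * Real.exp t := mul_pos hθ (Real.exp_pos t)
  refine add_nonneg (Finset.sum_nonneg fun k _ ↦ by positivity) (by positivity)

/-- **(K1) ⇒ `tailEnv ≤ envE` on the depth cells.** [E2 + TIER2-KERNEL-SPEC §5 (K1)] -/
theorem tailEnv_le_envE {qn : ℕ} (hP : P.Admissible qn) (hM : T2Matches P A X) (hV : T2Valid A X) :
    ∀ j < A.Jt, ∀ t : ℝ, (j : ℝ) * X.τ ≤ t → t ≤ ((j : ℝ) + 1) * X.τ → P.tailEnv t ≤ envE A j := by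
  intro j hj t h1 h2
  have hm : 1 ≤ P.m := le_trans (by norm_num) hP.three_le
  have h := hV.envE_le j hj t h1 h2
  rw [hM.m_eq, hM.θ₀_eq] at h
  have h2' := P.tailEnv_le_sine hP A.K t hM.R_ge
  have hS : Sfun P.θ₀ X.R P.m A.K t =
      (∑ k ∈ Ico 1 (A.K + 1), |Real.sin (k * (P.θ₀ * Real.exp t))| ^ P.m / (k : ℝ) ^ (P.m + 1)) + X.R := rfl
  have hS0 : 0 ≤ Real.exp (-(P.m + 1 / 2 : ℝ) * t) * Sfun P.θ₀ X.R P.m A.K t :=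
    mul_nonneg (Real.exp_pos _).le (Sfun_nonneg hM.R_nonneg _ _ _)
  have hc : 1 - P.cut (P.x₁ - t) ≤ X.cb j := (P.one_sub_cut_depth_le_irwinHall hP.eta_pos hm h2).trans (hM.cb_ge j hj)
  rw [← hS] at h2'
  exact h2'.trans ((mul_le_mul_of_nonneg_left hc hS0).trans h)

/-- **(K1′) ⇒ `‖T′(x₁ − t)‖/√u₁ ≤ envEp` on the depth cells.** [E2b + TIER2-KERNEL-SPEC §5 (K1)] -/
theorem deriv_T_le_envEp {qn : ℕ} (hP : P.Admissible qn) (hM : T2Matches P A X) (hV : T2Valid A X) :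
    ∀ j < A.Jt, ∀ t : ℝ, (j : ℝ) * X.τ ≤ t → t ≤ ((j : ℝ) + 1) * X.τ →
      ‖deriv P.T (P.x₁ - t)‖ / Real.sqrt P.u₁ ≤ envEp A j := by
  intro j hj t h1 h2
  have hm : 1 ≤ P.m := le_trans (by norm_num) hP.three_le
  obtain ⟨hε, -, -, hθ₀, -, hM₀, hM₁₀⟩ := P.e1_pos hP
  have hsu : 0 < Real.sqrt P.u₁ := Real.sqrt_pos.2 (Real.exp_pos _)
  have h := hV.envEp_le j hj t h1 h2
  rw [hM.m_eq, hM.θ₀_eq, hM.M₀_eq, hM.M₁₀_eq, hM.c₂_eq, hM.ε_eq] at h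
  have hE := P.norm_deriv_T_depth_le_sine hP A.K t hM.R_ge hM.Rm_ge
  have hS : Sfun P.θ₀ X.R P.m A.K t =
      (∑ k ∈ Ico 1 (A.K + 1), |Real.sin (k * (P.θ₀ * Real.exp t))| ^ P.m / (k : ℝ) ^ (P.m + 1)) + X.R := rfl
  have hS1 : S1fun P.θ₀ P.c₂ P.ε X.Rm P.m A.K t =
      (∑ k ∈ Ico 1 (A.K + 1), (P.c₂ * |Real.sin (k * (P.θ₀ * Real.exp t))| ^ P.m +
          P.ε * |Real.sin (k * (P.θ₀ * Real.exp t))| ^ (P.m - 1) * (1 + (P.θ₀ * Real.exp t)⁻¹ / k)) / (k : ℝ) ^ P.m)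
        + X.Rm * (P.c₂ + P.ε * (1 + (P.θ₀ * Real.exp t)⁻¹ / (A.K + 1))) := rfl
  rw [← hS, ← hS1] at hE
  have hSf0 := Sfun_nonneg hM.R_nonneg P.m A.K t (θ₀ := P.θ₀)
  have hS10 := S1fun_nonneg hθ₀ hP.c₂_pos.le hε.le hM.Rm_nonneg P.m A.K t
  have ha0 : 0 ≤ P.M₀ / 2 * Real.exp (-(P.m : ℝ) * t) * Sfun P.θ₀ X.R P.m A.K t +
      P.M₁₀ * Real.exp (-(P.m - 1 : ℝ) * t) * S1fun P.θ₀ P.c₂ P.ε X.Rm P.m A.K t := by positivity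
  have hb0 : 0 ≤ P.M₀ * Real.exp (-(P.m : ℝ) * t) * Sfun P.θ₀ X.R P.m A.K t := by positivity
  have hc := (P.one_sub_cut_depth_le_irwinHall hP.eta_pos hm h2).trans (hM.cb_ge j hj)
  have hcp := hM.cpb_ge j hj t h1 h2
  rw [div_le_iff₀ hsu]
  refine hE.trans ?_
  rw [mul_comm]
  refine mul_le_mul_of_nonneg_right ((mul_le_mul_of_nonneg_left (add_le_add (mul_le_mul_of_nonneg_left hc ha0)
    (mul_le_mul_of_nonneg_left hcp hb0)) (Real.exp_pos _).le).trans h) hsu.le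

/-! ## §2 The five hypotheses of `ucT2_of_bounds` -/

/-- **`Ā`**: `∫‖T_R⁻‖² ≤ val Ahi` for every `R`. [E3 + (K2)] -/
theorem integral_norm_sq_TROdd_le_Ahi {qn : ℕ} (hP : P.Admissible qn) (hM : T2Matches P A X) (hV : T2Valid A X) (R : ℝ) :
    ∫ x, ‖P.TROdd R x‖ ^ 2 ≤ val (ThetaTier2.run A).Ahi := by
  have h := P.integral_norm_sq_TROdd_le_cell hP hM.τ_pos (rfl : (A.Jt : ℝ) * X.τ = (A.Jt : ℝ) * X.τ) (tailEnv_le_envE hP hM hV) R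
  refine h.trans (le_trans ?_ hV.A_ge)
  obtain ⟨hMn, -⟩ := M_nonneg_M₁_nonneg hP
  have hu : 0 ≤ P.u₁ := (Real.exp_pos _).le
  rw [hM.M₀_eq, hM.m_eq]
  have hsum : 0 ≤ X.τ * P.M₀ ^ 2 * ∑ j ∈ Finset.range A.Jt, envE A j ^ 2 :=
    mul_nonneg (mul_nonneg hM.τ_pos.le (sq_nonneg _)) (Finset.sum_nonneg fun j _ ↦ sq_nonneg _)
  have h1 : P.M ^ 2 * Real.exp (-(2 * P.m + 1 : ℝ) * ((A.Jt : ℝ) * X.τ)) / (2 * P.m + 1) ≤ X.Mb ^ 2 * X.E1 / (2 * P.m + 1) := by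
    have : P.M ^ 2 * Real.exp (-(2 * P.m + 1 : ℝ) * ((A.Jt : ℝ) * X.τ)) ≤ X.Mb ^ 2 * X.E1 :=
      mul_le_mul (pow_le_pow_left₀ hMn hM.Mb_ge 2) hM.E1_ge (Real.exp_pos _).le (sq_nonneg _)
    exact div_le_div_of_nonneg_right this (by positivity)
  have hbr0 : 0 ≤ X.τ * P.M₀ ^ 2 * ∑ j ∈ Finset.range A.Jt, envE A j ^ 2 +
      P.M ^ 2 * Real.exp (-(2 * P.m + 1 : ℝ) * ((A.Jt : ℝ) * X.τ)) / (2 * P.m + 1) := by positivity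
  calc 2 * P.u₁ * (X.τ * P.M₀ ^ 2 * ∑ j ∈ Finset.range A.Jt, envE A j ^ 2 +
        P.M ^ 2 * Real.exp (-(2 * P.m + 1 : ℝ) * ((A.Jt : ℝ) * X.τ)) / (2 * P.m + 1))
      ≤ 2 * X.u₁ * (X.τ * P.M₀ ^ 2 * ∑ j ∈ Finset.range A.Jt, envE A j ^ 2 + X.Mb ^ 2 * X.E1 / (2 * P.m + 1)) :=
        mul_le_mul (by linarith [hM.u₁_ge]) (by linarith) hbr0 (by linarith [hM.u₁_ge])

/-- **`B̄`**: `∫‖(T⁻)′‖² ≤ val Bhi`. [E3 + (K2)] -/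
theorem integral_norm_sq_deriv_TOdd_le_Bhi {qn : ℕ} (hP : P.Admissible qn) (hM : T2Matches P A X) (hV : T2Valid A X) :
    ∫ x, ‖deriv P.TOdd x‖ ^ 2 ≤ val (ThetaTier2.run A).Bhi := by
  have h := P.integral_norm_sq_deriv_TOdd_le_cell hP hM.τ_pos (rfl : (A.Jt : ℝ) * X.τ = (A.Jt : ℝ) * X.τ) hM.eta_le_D
    (deriv_T_le_envEp hP hM hV)
  refine h.trans (le_trans ?_ hV.B_ge)
  obtain ⟨hMn, hM₁n⟩ := M_nonneg_M₁_nonneg hP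
  rw [hM.m_eq]
  have hm1 : (1 : ℝ) ≤ P.m := by exact_mod_cast (le_trans (by norm_num) hP.three_le : 1 ≤ P.m)
  have hd1 : (0 : ℝ) < 2 * P.m + 1 := by positivity
  have hd2 : (0 : ℝ) < 2 * P.m := by positivity
  have hd3 : (0 : ℝ) < 2 * P.m - 1 := by linarith
  have hsum : 0 ≤ X.τ * ∑ j ∈ Finset.range A.Jt, envEp A j ^ 2 :=
    mul_nonneg hM.τ_pos.le (Finset.sum_nonneg fun j _ ↦ sq_nonneg _)
  have t1 : (P.M / 2) ^ 2 * Real.exp (-(2 * P.m + 1 : ℝ) * ((A.Jt : ℝ) * X.τ)) / (2 * P.m + 1) ≤ X.Mb ^ 2 / 4 * X.E1 / (2 * P.m + 1) := by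
    refine div_le_div_of_nonneg_right ?_ hd1.le
    rw [show (P.M / 2) ^ 2 = P.M ^ 2 / 4 by ring]
    exact mul_le_mul (div_le_div_of_nonneg_right (pow_le_pow_left₀ hMn hM.Mb_ge 2) (by norm_num)) hM.E1_ge
      (Real.exp_pos _).le (by positivity)
  have t2 : P.M * P.M₁ * Real.exp (-(2 * P.m : ℝ) * ((A.Jt : ℝ) * X.τ)) / (2 * P.m) ≤ X.Mb * X.Mb1 * X.E2 / (2 * P.m) := by
    refine div_le_div_of_nonneg_right ?_ hd2.le
    exact mul_le_mul (mul_le_mul hM.Mb_ge hM.Mb1_ge hM₁n (hMn.trans hM.Mb_ge)) hM.E2_ge (Real.exp_pos _).le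
      (mul_nonneg (hMn.trans hM.Mb_ge) (hM₁n.trans hM.Mb1_ge))
  have t3 : P.M₁ ^ 2 * Real.exp (-(2 * P.m - 1 : ℝ) * ((A.Jt : ℝ) * X.τ)) / (2 * P.m - 1) ≤ X.Mb1 ^ 2 * X.E3 / (2 * P.m - 1) := by
    refine div_le_div_of_nonneg_right ?_ hd3.le
    exact mul_le_mul (pow_le_pow_left₀ hM₁n hM.Mb1_ge 2) hM.E3_ge (Real.exp_pos _).le (sq_nonneg _)
  have hbr0 : 0 ≤ X.τ * ∑ j ∈ Finset.range A.Jt, envEp A j ^ 2 +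
      ((P.M / 2) ^ 2 * Real.exp (-(2 * P.m + 1 : ℝ) * ((A.Jt : ℝ) * X.τ)) / (2 * P.m + 1) +
        P.M * P.M₁ * Real.exp (-(2 * P.m : ℝ) * ((A.Jt : ℝ) * X.τ)) / (2 * P.m) +
        P.M₁ ^ 2 * Real.exp (-(2 * P.m - 1 : ℝ) * ((A.Jt : ℝ) * X.τ)) / (2 * P.m - 1)) := by positivity
  have hu : 0 ≤ P.u₁ := (Real.exp_pos _).le
  exact mul_le_mul (by linarith [hM.u₁_ge]) (by linarith) hbr0 (by linarith [hM.u₁_ge])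

/-- **The prime bound**: `‖primes(T_R⁻ ⋆ T̃_R⁻)‖ ≤ primesC + 2·X.C·M₀²·[GsR 0 + Σ_{k<Kw} GsR_kΔ_k + ζ(m+1)²e^{−mW_l}(W_l/m+1/m²)]`, every `R`,
under `ψ ≤ X.C·x` on `[e^{−2x₁}, ∞)`. [Step5T2 + CrossGlue + (K4)] -/
theorem norm_weilPrimeTerm_TROdd_le_valid {qn : ℕ} (hP : P.Admissible qn) (hM : T2Matches P A X) (hV : T2Valid A X)
    (hψ : ∀ x : ℝ, Real.exp (-2 * P.x₁) ≤ x → Chebyshev.psi x ≤ X.C * x) (R : ℝ) :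
    ‖weilPrimeTerm (weilConv (P.TROdd R) (weilReflect (P.TROdd R)))‖ ≤
      P.primesC + 2 * X.C * P.M₀ ^ 2 * (GsR A 0 +
        ∑ k ∈ Finset.range A.Kw, GsR A k * (Real.exp ((k + 1) * X.τ) - Real.exp (k * X.τ)) +
        zetaTail (P.m + 1) ^ 2 * Real.exp (-(P.m : ℝ) * ((A.Kw : ℝ) * X.τ)) * ((A.Kw : ℝ) * X.τ / P.m + 1 / (P.m : ℝ) ^ 2)) := by
  have hζ : 0 ≤ zetaTail (P.m + 1) := le_trans (P.tailEnv_nonneg hP 0) (by simpa using P.tailEnv_le_exp hP 0)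
  have hz : 0 ≤ X.z := hζ.trans hM.z_ge
  obtain ⟨hH, hGs, hGs0, hanti, hGt⟩ := hV.cross_hyps
  have hexp : ∀ s : ℝ, 0 ≤ s → P.tailEnv s ≤ X.z * Real.exp (-(A.m + 1 / 2 : ℝ) * s) := fun s _ ↦ by
    rw [hM.m_eq]
    exact (P.tailEnv_le_exp hP s).trans (mul_le_mul_of_nonneg_right hM.z_ge (Real.exp_pos _).le)
  have henv := hV.cellEnvelope_all hM.τ_pos.le hz hexp (tailEnv_le_envE hP hM hV)
  have hglue : zetaTail (P.m + 1) ^ 2 * ((A.Kw : ℝ) * X.τ) * Real.exp (-((P.m : ℝ) + 1) * ((A.Kw : ℝ) * X.τ)) ≤ GsR A A.Kw :=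
    hM.Gt_ge.trans hGt
  exact P.norm_weilPrimeTerm_TROdd_le_T2 hP hM.C_nonneg hψ hM.τ_pos rfl hM.Wl_ge (ThetaTier2.envExt_envX_nonneg A hz) henv
    hH hGs hGs0 hanti hglue R

/-- **The layer constant**: `L = M₀·val sLayer·e^{m(2δ−η)}` dominates `‖Θ(eᵛ)‖` on `[−a, 2δ − a]`. [E1 + E8 + (K1L)] -/
theorem layer_of_valid {qn : ℕ} (hP : P.Admissible qn) (hM : T2Matches P A X) (hV : T2Valid A X) :
    0 ≤ P.M₀ * val (sLayerN A) * Real.exp (P.m * (2 * P.δ - P.η)) ∧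
      ∀ v : ℝ, -P.a ≤ v → v ≤ 2 * P.δ - P.a →
        ‖P.Θ (Real.exp v)‖ ≤ P.M₀ * val (sLayerN A) * Real.exp (P.m * (2 * P.δ - P.η)) := by
  by_cases hw : A.j0 < A.j1p
  · refine P.layer_majorant_ML₂ hP A.K hM.R_ge (ThetaTier2.val_nonneg _) fun t ht1 ht2 ↦ ?_
    have h := hV.layer_le hw t ((hM.layer_lo hw).trans ht1) (ht2.trans (hM.layer_hi hw))
    rw [hM.m_eq, hM.θ₀_eq] at h
    exact h
  · -- fallback: the exact residue and `S ≤ ζ(m+1) ≤ val zm1H = val sLayer`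
    have htail := hV.layer_tail hw
    refine P.layer_majorant_ML₂ hP A.K (R := zetaTail (P.m + 1) - ∑ k ∈ Finset.Ico 1 (A.K + 1), 1 / (k : ℝ) ^ (P.m + 1)) le_rfl
      (ThetaTier2.val_nonneg _) fun t _ _ ↦ ?_
    rw [htail]
    refine le_trans ?_ hM.zm1H_ge
    have hterm : ∀ k ∈ Finset.Ico 1 (A.K + 1), |Real.sin (k * (P.θ₀ * Real.exp t))| ^ P.m / (k : ℝ) ^ (P.m + 1) ≤ 1 / (k : ℝ) ^ (P.m + 1) :=
      fun k _ ↦ div_le_div_of_nonneg_right (pow_le_one₀ (abs_nonneg _) (Real.abs_sin_le_one _)) (by positivity)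
    linarith [Finset.sum_le_sum hterm]

/-- **The gain**: `2·X.L·(2·Σ_j X.d·X.Ra j·X.Rb j) ≤ P.gain J`, `J = |gainPairs|`. [D8; (K6)] -/
theorem kernelGain_le_gain {qn : ℕ} (hP : P.Admissible qn) (hM : T2Matches P A X) (hq : 1 ≤ P.q) :
    2 * X.L * (2 * ∑ j ∈ Finset.range A.gainPairs.length, X.d * X.Ra j * X.Rb j) ≤ P.gain A.gainPairs.length := by
  set J := A.gainPairs.length with hJ
  have hδ := hP.delta_pos
  have hlog : 0 ≤ Real.log P.q := Real.log_nonneg (by exact_mod_cast hq)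
  have hterm : ∀ j ∈ Finset.range J, X.d * X.Ra j * X.Rb j ≤
      P.δ / J * P.Rtop (((P.δ * j / J) - (P.δ * j / J) ^ 2 / 2) / (2 * P.δ)) *
        P.Rtop (((2 * P.δ - P.δ * (j + 1) / J) - (2 * P.δ - P.δ * (j + 1) / J) ^ 2 / 2) / (2 * P.δ)) := by
    intro j hj
    have hj' := Finset.mem_range.1 hj
    have hR1 := (Rtop_mem_Icc hP (((P.δ * j / J) - (P.δ * j / J) ^ 2 / 2) / (2 * P.δ))).1
    exact mul_le_mul (mul_le_mul hM.d_le (hM.Ra_le j hj') (hM.Ra_nonneg j) (by positivity)) (hM.Rb_le j hj')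
      (hM.Rb_nonneg j) (mul_nonneg (by positivity) hR1)
  have hS0 : 0 ≤ ∑ j ∈ Finset.range J, X.d * X.Ra j * X.Rb j :=
    Finset.sum_nonneg fun j _ ↦ mul_nonneg (mul_nonneg hM.d_nonneg (hM.Ra_nonneg j)) (hM.Rb_nonneg j)
  have hsum := Finset.sum_le_sum hterm
  unfold gain Ilo
  have h1 : 2 * X.L * (2 * ∑ j ∈ Finset.range J, X.d * X.Ra j * X.Rb j) ≤
      2 * Real.log P.q * (2 * ∑ j ∈ Finset.range J, X.d * X.Ra j * X.Rb j) := by nlinarith [hM.L_le]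
  refine h1.trans ?_
  exact mul_le_mul_of_nonneg_left (by linarith) (by positivity)

/-! ## §3 The theorem -/

/-- **THE TIER-2 ANALYTIC THEOREM.** For an admissible row `P` with consecutive primes `q < q⁺`, `ψ(x) ≤ X.C·x` on `[e^{−2x₁}, ∞)`,
real data `X` matching `P` (`T2Matches`) and a certified kernel run (`T2Valid A X`, from cc-s2-1's `certify_sound`):
**`a*(S_q) < (log q⁺)/2`**. [THETA-CERT-cc6 §E; TIER2-KERNEL-SPEC §0; TIER2-SOUNDNESS-PLAN §0; RH-FREE] -/
theorem ucT2_of_valid {qn : ℕ} (hP : P.Admissible qn) (hcons : Handoff.ConsecutivePrimes P.q qn)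
    (hψ : ∀ x : ℝ, Real.exp (-2 * P.x₁) ≤ x → Chebyshev.psi x ≤ X.C * x)
    (hM : T2Matches P A X) (hV : T2Valid A X) :
    MotivicDoor.SemilocalThreshold.weilSemilocalThreshold (Nat.primesBelow P.q) < Real.log qn / 2 := by
  have hq1 : 1 ≤ P.q := le_trans (by norm_num) hcons.1.two_le
  obtain ⟨hL0', hΘL'⟩ := layer_of_valid hP hM hV
  obtain ⟨-, -, -, -, -, hM₀, -⟩ := P.e1_pos hP
  -- the certificate inequality, read before naming the kernel reals
  have hK7 := hV.loss_lt_gain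
  rw [hM.m_eq, hM.M₀_eq] at hK7
  set L : ℝ := P.M₀ * val (sLayerN A) * X.eml with hLdef
  have hLL : P.M₀ * val (sLayerN A) * Real.exp (P.m * (2 * P.δ - P.η)) ≤ L :=
    mul_le_mul_of_nonneg_left hM.eml_ge (mul_nonneg hM₀ (ThetaTier2.val_nonneg _))
  have hL0 : 0 ≤ L := hL0'.trans hLL
  have hΘL : ∀ v : ℝ, -P.a ≤ v → v ≤ 2 * P.δ - P.a → ‖P.Θ (Real.exp v)‖ ≤ L := fun v h1 h2 ↦ (hΘL' v h1 h2).trans hLL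
  set Abar : ℝ := val (ThetaTier2.run A).Ahi with hAdef
  set Bbar : ℝ := val (ThetaTier2.run A).Bhi with hBdef
  set Pv : ℝ := P.primesC + 2 * X.C * P.M₀ ^ 2 * (GsR A 0 +
    ∑ k ∈ Finset.range A.Kw, GsR A k * (Real.exp ((k + 1) * X.τ) - Real.exp (k * X.τ)) +
    zetaTail (P.m + 1) ^ 2 * Real.exp (-(P.m : ℝ) * ((A.Kw : ℝ) * X.τ)) * ((A.Kw : ℝ) * X.τ / P.m + 1 / (P.m : ℝ) ^ 2)) with hPv
  have hAR : ∀ R : ℝ, 0 ≤ R → ∫ x, ‖P.TROdd R x‖ ^ 2 ≤ Abar := fun R _ ↦ integral_norm_sq_TROdd_le_Ahi hP hM hV R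
  have hB : ∫ x, ‖deriv P.TOdd x‖ ^ 2 ≤ Bbar := integral_norm_sq_deriv_TOdd_le_Bhi hP hM hV
  have hprime : ∀ R : ℝ, 0 ≤ R → ‖weilPrimeTerm (weilConv (P.TROdd R) (weilReflect (P.TROdd R)))‖ ≤ Pv := fun R _ ↦
    norm_weilPrimeTerm_TROdd_le_valid hP hM hV hψ R
  -- the certificate inequality in `ucT2_of_bounds`' currency
  obtain ⟨hMn, -⟩ := M_nonneg_M₁_nonneg hP
  have hu : 0 < P.u₁ := Real.exp_pos _
  have hA0 : 0 ≤ Abar := le_trans (integral_nonneg fun x ↦ by positivity) (hAR 0 le_rfl)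
  have hB0 : 0 ≤ Bbar := le_trans (integral_nonneg fun x ↦ by positivity) hB
  -- primesC
  have hPC : P.primesC ≤ 4 * X.Mb ^ 2 * X.u₁ / (2 * P.m + 1) * X.Λ := by
    unfold primesC
    have hv0 : 0 ≤ vonMangoldtSum (P.m + 1) := by
      unfold vonMangoldtSum; exact tsum_nonneg fun n ↦ div_nonneg ArithmeticFunction.vonMangoldt_nonneg (by positivity)
    have h1 : 4 * P.M ^ 2 * P.u₁ / (2 * P.m + 1) ≤ 4 * X.Mb ^ 2 * X.u₁ / (2 * P.m + 1) :=
      div_le_div_of_nonneg_right (mul_le_mul (mul_le_mul_of_nonneg_left (pow_le_pow_left₀ hMn hM.Mb_ge 2) (by norm_num))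
        hM.u₁_ge hu.le (by positivity)) (by positivity)
    exact mul_le_mul h1 hM.Λ_ge hv0 (by have := hu.le.trans hM.u₁_ge; positivity)
  -- cross
  have hGs0 : ∀ k, 0 ≤ GsR A k := ThetaTier2.GsR_nonneg A
  have hΔ : 0 ≤ ∑ k ∈ Finset.range A.Kw, GsR A k * (Real.exp ((k + 1) * X.τ) - Real.exp (k * X.τ)) :=
    Finset.sum_nonneg fun k _ ↦ mul_nonneg (hGs0 k)
      (by nlinarith [Real.exp_lt_exp.2 (show (k : ℝ) * X.τ < (k + 1) * X.τ by nlinarith [hM.τ_pos])])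
  have hCr : 2 * X.C * P.M₀ ^ 2 * (GsR A 0 +
      ∑ k ∈ Finset.range A.Kw, GsR A k * (Real.exp ((k + 1) * X.τ) - Real.exp (k * X.τ)) +
      zetaTail (P.m + 1) ^ 2 * Real.exp (-(P.m : ℝ) * ((A.Kw : ℝ) * X.τ)) * ((A.Kw : ℝ) * X.τ / P.m + 1 / (P.m : ℝ) ^ 2)) ≤
      2 * X.C * P.M₀ ^ 2 * (GsR A 0 +
      ∑ k ∈ Finset.range A.Kw, GsR A k * (Real.exp (((k : ℝ) + 1) * X.τ) - Real.exp ((k : ℝ) * X.τ)) + X.T) := by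
    refine mul_le_mul_of_nonneg_left ?_ (by have := hM.C_nonneg; positivity)
    linarith [hM.T_ge]
  -- arch
  have hArch : Bbar / 2 * Real.exp (X.t0 / 2) * X.t0 ^ 2 / 2 +
      Abar * max 0 (2 * Jexplicit X.t0 - Real.log (4 * π) - Real.eulerMascheroniConstant - archC₁) ≤
      Bbar * X.e0 * X.t0 ^ 2 / 4 + Abar * X.cA := by
    have h1 : Bbar / 2 * Real.exp (X.t0 / 2) * X.t0 ^ 2 / 2 ≤ Bbar * X.e0 * X.t0 ^ 2 / 4 := by
      have := mul_le_mul_of_nonneg_left hM.e0_ge (mul_nonneg hB0 (sq_nonneg X.t0))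
      nlinarith
    have h2 := mul_le_mul_of_nonneg_left hM.cA_ge hA0
    linarith
  -- atom
  have hAt : 2 * Real.log P.q / Real.sqrt P.q *
      (4 * P.δ * Real.exp P.δ * P.hmax * L * P.chiL + 2 * P.δ * (Real.exp P.δ / Real.sqrt P.q) * L ^ 2 * P.chiL ^ 2) ≤
      X.rc * (X.ra * L * X.χ + X.rb * L ^ 2 * X.χ ^ 2) := by
    have hχ0 : 0 ≤ P.chiL := (P.cut_mem_Icc hP.eta_pos (le_trans (by norm_num) hP.three_le) _).1
    have hδ := hP.delta_pos
    have hq0 : (0 : ℝ) < P.q := by exact_mod_cast (lt_of_lt_of_le (by norm_num) hq1)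
    have hrc0 : 0 ≤ 2 * Real.log P.q / Real.sqrt P.q := div_nonneg (by linarith [Real.log_nonneg (show (1:ℝ) ≤ P.q by exact_mod_cast hq1)])
      (Real.sqrt_nonneg _)
    have hra0 : 0 ≤ 4 * P.δ * Real.exp P.δ * P.hmax := by have : 0 ≤ P.hmax := le_trans zero_le_one (le_max_left _ _); positivity
    have hrb0 : 0 ≤ 2 * P.δ * (Real.exp P.δ / Real.sqrt P.q) := by positivity
    have t1 : 4 * P.δ * Real.exp P.δ * P.hmax * L * P.chiL ≤ X.ra * L * X.χ := by
      have := mul_le_mul (mul_le_mul_of_nonneg_right hM.ra_ge hL0) hM.χ_ge hχ0 (mul_nonneg (hra0.trans hM.ra_ge) hL0)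
      linarith [this]
    have t2 : 2 * P.δ * (Real.exp P.δ / Real.sqrt P.q) * L ^ 2 * P.chiL ^ 2 ≤ X.rb * L ^ 2 * X.χ ^ 2 := by
      have := mul_le_mul (mul_le_mul_of_nonneg_right hM.rb_ge (sq_nonneg L)) (pow_le_pow_left₀ hχ0 hM.χ_ge 2) (sq_nonneg _)
        (mul_nonneg (hrb0.trans hM.rb_ge) (sq_nonneg L))
      linarith [this]
    have hin0 : 0 ≤ 4 * P.δ * Real.exp P.δ * P.hmax * L * P.chiL + 2 * P.δ * (Real.exp P.δ / Real.sqrt P.q) * L ^ 2 * P.chiL ^ 2 := by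
      positivity
    exact mul_le_mul hM.rc_ge (by linarith) hin0 (hrc0.trans hM.rc_ge)
  have hgain := kernelGain_le_gain hP hM hq1
  have hlg : Pv + (Bbar / 2 * Real.exp (X.t0 / 2) * X.t0 ^ 2 / 2 +
        Abar * max 0 (2 * Jexplicit X.t0 - Real.log (4 * π) - Real.eulerMascheroniConstant - archC₁)) +
      2 * Real.log P.q / Real.sqrt P.q *
        (4 * P.δ * Real.exp P.δ * P.hmax * L * P.chiL + 2 * P.δ * (Real.exp P.δ / Real.sqrt P.q) * L ^ 2 * P.chiL ^ 2)
      < P.gain A.gainPairs.length := by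
    rw [hPv]
    linarith
  exact ucT2_of_bounds hP hcons hAR hB hprime hL0 hΘL hM.t0_pos hM.t0_le_one hM.gain_len_pos hlg

/-- **THE TIER-2 ANALYTIC THEOREM, CHEBYSHEV FORM (no hypothesis on `ψ`)**: if `e² ≤ N = e^{−2x₁}` and the kernel's ψ-constant
satisfies `C(N) = log 4 + 2·log N/√N ≤ X.C`, then `T2Matches P A X → T2Valid A X → a*(S_q) < (log q⁺)/2`
(Mathlib's Chebyshev bound via `ThetaPrime.psi_le_cheb_linear`). [Chebyshev; THETA-CERT-cc6 §E; TIER2-KERNEL-SPEC §0/§4; RH-FREE] -/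
theorem ucT2Cheb_of_valid {qn : ℕ} (hP : P.Admissible qn) (hcons : Handoff.ConsecutivePrimes P.q qn)
    (hN : Real.exp 2 ≤ Real.exp (-2 * P.x₁))
    (hC : Real.log 4 + 2 * (Real.log (Real.exp (-2 * P.x₁)) / Real.sqrt (Real.exp (-2 * P.x₁))) ≤ X.C)
    (hM : T2Matches P A X) (hV : T2Valid A X) :
    MotivicDoor.SemilocalThreshold.weilSemilocalThreshold (Nat.primesBelow P.q) < Real.log qn / 2 :=
  ucT2_of_valid hP hcons (fun _ hx ↦ (ThetaPrime.psi_le_cheb_linear hN hx).trans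
    (mul_le_mul_of_nonneg_right hC ((Real.exp_pos _).le.trans hx))) hM hV

end ThetaParams

end Summit.RiemannHypothesis.RiemannHypothesis.Theorems.WeilColumn.ThetaMellin

end
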